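import Literature.AlgebraicGeometry.Modules.CechOrderedComputesCohomology
import Literature.AlgebraicGeometry.Modules.CechComputesCohomology
import Literature.Algebra.Homology.ExtOfAcyclicResolutionNaturality
import Mathlib.Data.Finset.Sort
import HarnessLib

/-!
# The restriction `res : Č•(𝓤, M) → Č•_ord(𝓤, M)` from the full to the ordered sheaf Čech complex is an isomorphism
# on cohomology (The Stacks Project, Tags 01FG, 01FM; Serre FAC n° 20; Görtz–Wedhorn II Thm. 22.9)

Topic `AlgebraicGeometry/Modules`; namespace `Literature.AlgebraicGeometry.Modules`.  PROOF file in spirit (one sheaf-level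
morphism of complexes `CechOrd.resOfFull` with its unfolding lemma, then theorems); no named fact, no instance, no notation, no
`sorry`.  Cell `hodgecm-mathlib` FLOOR 0, P1 sub-line F-11, packet (iv)∕J3, brick **(T3)** road **(T3-nat)** (F0P1b-plan (g0)
RULINGS #3 (R14); F0P1b-p01 (g0)).

For a scheme `X`, a finite linearly ordered family of opens `𝓤 = (U_i)` and an `𝒪_X`-module `M` the tree has TWO sheaf Čech
resolutions of `M`: the FULL one ★ `Cech.complex U M` (`Modules/CechResolution`, one component per tuple) and the ORDERED one
★ `CechOrd.complex U M` (`Modules/CechOrderedComplex`, one component per strictly increasing tuple), each with its Leray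
isomorphism `Extⁿ⁺¹(𝒪_X, M) ≃+ Hⁿ⁺¹(Γ(X, ·))` for affine-faced covers and affine-localizing `M` (★ `Cech.extUnitAddEquivHomologySucc`,
★ `CechOrd.extUnitAddEquivHomologySucc`).  This file builds

* §1 **`CechOrd.resOfFull U M : Cech.complex U M ⟶ CechOrd.complex U M`** — keep the components at the sorted enumerations
  `e_σ` of the simplices `σ` (`resOfFull_app_apply`); a morphism of complexes (faces of increasing tuples are increasing, and the
  two sign conventions agree: `ε(σ, e_σ j) = (-1)^j`) compatible with the augmentations (`augment_resOfFull`);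
* §2 **`CechOrd.homologyMap_resOfFull_extUnitAddEquivHomologySucc`** — the Leray square: `H(res) ∘ Leray_full = Leray_ord`
  (★ `AcyclicResolution.extAddEquivHomologySucc_naturality` for the morphism of exact acyclic resolutions `(𝟙_M, res)`), whence
  **`CechOrd.homologyMap_resOfFull_bijective`**: `Hⁿ⁺¹(Γ(X, res))` is BIJECTIVE — no properness, no dimension count.

Consequence (the (iv)∕J3 consumers, via the module-level dictionaries ★ `Modules/ModuleCechFiniteOfProper.exists_cechSectionsAddEquiv`
and `Algebra/Homology/OrderedCechSystemFull(Ring)`): the ring `Ȟ•_ord(𝓤)` is the transport of the ORDER-FREE ring `H(Č•_full(𝓤))`,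
so pull-backs along arbitrary index maps (`p₂, m, sw, [n]` on lexicographic product covers) are multiplicative on cohomology.
[StacksProject, Tag 01FM]: «the map of complexes `Č•_ord(𝓤, 𝓕) → Č•(𝓤, 𝓕)` … is a homotopy equivalence»; here only the
cohomology statement, by Leray instead of the explicit homotopy.

## References
* The Stacks Project, Tags 01FG, 01FM (ordered∕alternating vs. full Čech complex), Tag 01XD. [StacksProject]
* J.-P. Serre, *Faisceaux algébriques cohérents*, Ann. of Math. 61 (1955), n° 20 Prop. 2. [folklore]
* U. Görtz, T. Wedhorn, *Algebraic Geometry II* (2023), Def. 21.64, Def. 21.68, Thm. 22.9 (p. 236). [GortzWedhorn2023]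
* R. Hartshorne, *Algebraic Geometry*, GTM 52 (1977), III Thm. 4.5. [Hartshorne1977]
-/

noncomputable section

universe w u

open CategoryTheory CategoryTheory.Abelian CategoryTheory.Limits Opposite TopologicalSpace AlgebraicGeometry
open Literature.Algebra.Homology

namespace Literature.AlgebraicGeometry.Modules

namespace CechOrd

variable {X : Scheme.{u}} {ι : Type u} [LinearOrder ι] [Fintype ι] (U : ι → X.Opens) (M : X.Modules)

/-! ## §1 The restriction from the full to the ordered Čech complex -/

/-- The sorted enumeration of the simplex underlying an index `β` of the ordered complex. [cite: StacksProject, Tag 01FG] -/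
def enum {n : ℕ} (β : Idx ι n) : Fin (n + 1) → ι := ⇑((β 0).1.orderEmbOfFin (β 0).2)

omit [Fintype ι] in
/-- The values of the enumeration lie in the simplex. [cite: StacksProject, Tag 01FG] -/
theorem enum_mem {n : ℕ} (β : Idx ι n) (k : Fin (n + 1)) : enum β k ∈ (β 0).1 :=
  Finset.orderEmbOfFin_mem _ _ k

omit [Fintype ι] in
/-- The face of the ordered complex at `β` lies in the face of the full complex at its enumeration (they are equal).
[cite: StacksProject, Tag 01FG] -/
theorem face_faces_le_face_enum {n : ℕ} (β : Idx ι n) : face (faces U n) β ≤ face U (enum β) := by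
  rw [face_faces]
  exact le_iInf fun k => faceSet_le (U := U) (enum_mem β k)

omit [Fintype ι] in
/-- The restriction inequality used to define `resOfFull`. [cite: StacksProject, Tag 01FG] -/
theorem inf_face_faces_le (V : X.Opens) {n : ℕ} (β : Idx ι n) : V ⊓ face (faces U n) β ≤ V ⊓ face U (enum β) :=
  inf_le_inf_left V (face_faces_le_face_enum U β)

/-- The restriction on sections: `(res s)_σ = s_{e_σ}|`. [cite: StacksProject, Tag 01FG] -/
def resFun (n : ℕ) (V : X.Opens) (s : Cech.Sections U n M V) : Cech.Sections (faces U n) 0 M V :=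
  fun β => Cech.res M (inf_face_faces_le U V β) (s (enum β))

/-- **The restriction `res : Čⁿ(𝓤, M) → Čⁿ_ord(𝓤, M)`** as a morphism of `𝒪_X`-modules: keep the components at the sorted
enumerations of the simplices. [cite: StacksProject, Tag 01FG] -/
def resOfFullObj (n : ℕ) : Cech.obj U n M ⟶ obj U M n :=
  Cech.homMk (resFun U M n)
    (fun V s t => funext fun β => by
      rw [Cech.add_apply]
      unfold resFun
      rw [Cech.obj_add_apply, map_add])
    (fun V r s => funext fun β => by
      rw [Cech.smul_apply]
      unfold resFun
      rw [Cech.obj_smul_apply, Cech.res_smul, Cech.resO_resO])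
    (fun V W i s => funext fun β => by
      rw [Cech.restrict_apply]
      unfold resFun
      rw [Cech.obj_map_apply, Cech.res_res, Cech.res_res])

omit [Fintype ι] in
/-- Components of the restriction. [cite: StacksProject, Tag 01FG] -/
@[simp] theorem resOfFullObj_app_apply (n : ℕ) (V : X.Opens) (s : Γ(Cech.obj U n M, V)) (β : Idx ι n) :
    ((resOfFullObj U M n).app V s : Cech.Sections (faces U n) 0 M V) β =
      Cech.res M (inf_face_faces_le U V β) ((s : Cech.Sections U n M V) (enum β)) := rfl

omit [Fintype ι] in
/-- The rank of the `j`-th vertex: `ε(τ, e_τ j) = (-1)^j` (the ordered and the cosimplicial sign conventions agree).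
[cite: StacksProject, Tag 01FG] [cite: GortzWedhorn2023, Def. 21.64 (p. 179)] -/
theorem sgn_enum {n : ℕ} (β : Idx ι n) (j : Fin (n + 1)) : sgn (β 0).1 (enum β j) = (-1) ^ (j : ℕ) := by
  classical
  unfold sgn enum
  have he : (β 0).1.filter (· < (β 0).1.orderEmbOfFin (β 0).2 j) =
      (Finset.Iio j).image ((β 0).1.orderEmbOfFin (β 0).2) := by
    ext x
    simp only [Finset.mem_filter, Finset.mem_image, Finset.mem_Iio]
    constructor
    · rintro ⟨hx, hlt⟩
      have hx' : x ∈ Set.range ((β 0).1.orderEmbOfFin (β 0).2) := by rw [Finset.range_orderEmbOfFin]; exact hx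
      obtain ⟨i, rfl⟩ := hx'
      exact ⟨i, ((β 0).1.orderEmbOfFin (β 0).2).lt_iff_lt.mp hlt, rfl⟩
    · rintro ⟨i, hi, rfl⟩
      exact ⟨Finset.orderEmbOfFin_mem _ _ i, ((β 0).1.orderEmbOfFin (β 0).2).lt_iff_lt.mpr hi⟩
  rw [he, Finset.card_image_of_injective _ ((β 0).1.orderEmbOfFin (β 0).2).injective, Fin.card_Iio]

omit [Fintype ι] in
/-- Deleting the `j`-th vertex: the enumeration of `τ ∖ e_τ j` is `e_τ ∘ δ_j` (faces of increasing tuples are increasing).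
[cite: StacksProject, Tag 01FG] -/
theorem enum_delIdx {n : ℕ} (γ : Idx ι (n + 1)) (j : Fin (n + 2)) :
    enum (delIdx γ (enum γ j) (enum_mem γ j)) = enum γ ∘ Fin.succAbove j := by
  symm
  refine Finset.orderEmbOfFin_unique _ (fun i => ?_) ?_
  · rw [delIdx_val]
    exact Finset.mem_erase.mpr ⟨fun he => Fin.succAbove_ne j i (((γ 0).1.orderEmbOfFin (γ 0).2).injective he),
      enum_mem γ _⟩
  · exact ((γ 0).1.orderEmbOfFin (γ 0).2).strictMono.comp (Fin.strictMono_succAbove j)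

omit [Fintype ι] in
/-- The restriction inequality for the `j`-th face term. [cite: StacksProject, Tag 01FG] -/
theorem inf_face_faces_le_comp_succAbove (V : X.Opens) {n : ℕ} (γ : Idx ι (n + 1)) (j : Fin (n + 2)) :
    V ⊓ face (faces U (n + 1)) γ ≤ V ⊓ face U (enum γ ∘ Fin.succAbove j) :=
  (inf_face_faces_le U V γ).trans (inf_le_inf_left V (face_le_face_comp U (enum γ) (Fin.succAbove j)))

omit [Fintype ι] in
/-- One term of the ordered differential of a restricted cochain, read at the position `j` of the deleted vertex.
[cite: StacksProject, Tag 01FG] -/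
theorem sgn_smul_res_resOfFullObj_delIdx {n : ℕ} (V : X.Opens) (s : Γ(Cech.obj U n M, V)) (γ : Idx ι (n + 1))
    (j : Fin (n + 2)) :
    sgn (γ 0).1 (enum γ j) • Cech.res M (inf_face_le U V γ (delIdx γ (enum γ j) (enum_mem γ j)) (Finset.erase_subset _ _))
        (((resOfFullObj U M n).app V s : Cech.Sections (faces U n) 0 M V) (delIdx γ (enum γ j) (enum_mem γ j))) =
      (-1 : ℤ) ^ (j : ℕ) • Cech.res M (inf_face_faces_le_comp_succAbove U V γ j)
        ((s : Cech.Sections U n M V) (enum γ ∘ Fin.succAbove j)) := by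
  rw [sgn_enum, resOfFullObj_app_apply, Cech.res_res]
  congr 1
  exact Cech.res_apply_congr (s : Cech.Sections U n M V) (enum_delIdx γ j) _ _

/-- The ordered differential of a restricted cochain, as a sum over positions. [cite: StacksProject, Tag 01FG] -/
theorem d_app_resOfFullObj_apply {n : ℕ} (V : X.Opens) (s : Γ(Cech.obj U n M, V)) (γ : Idx ι (n + 1)) :
    ((d U M n).app V ((resOfFullObj U M n).app V s) : Cech.Sections (faces U (n + 1)) 0 M V) γ =
      ∑ j : Fin (n + 2), (-1 : ℤ) ^ (j : ℕ) • Cech.res M (inf_face_faces_le_comp_succAbove U V γ j)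
        ((s : Cech.Sections U n M V) (enum γ ∘ Fin.succAbove j)) := by
  classical
  rw [d_app_apply_eq_sum_attach, Finset.attach_eq_univ]
  symm
  refine Fintype.sum_equiv ((γ 0).1.orderIsoOfFin (γ 0).2).toEquiv _ _ fun j => ?_
  have hj : ((((γ 0).1.orderIsoOfFin (γ 0).2).toEquiv j : {x // x ∈ (γ 0).1}) : ι) = enum γ j :=
    Finset.coe_orderIsoOfFin_apply _ _ j
  -- replace the vertex by `enum γ j`
  have key : ∀ (a : {x // x ∈ (γ 0).1}), (a : ι) = enum γ j →
      sgn (γ 0).1 a • Cech.res M (inf_face_le U V γ (delIdx γ a a.2) (Finset.erase_subset _ _))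
        (((resOfFullObj U M n).app V s : Cech.Sections (faces U n) 0 M V) (delIdx γ a a.2)) =
      (-1 : ℤ) ^ (j : ℕ) • Cech.res M (inf_face_faces_le_comp_succAbove U V γ j)
        ((s : Cech.Sections U n M V) (enum γ ∘ Fin.succAbove j)) := by
    rintro ⟨a, ha'⟩ (rfl : a = enum γ j)
    exact sgn_smul_res_resOfFullObj_delIdx U M V s γ j
  exact (key _ hj).symm

omit [Fintype ι] in
/-- The restriction of the full differential of a cochain, as a sum over positions. [cite: StacksProject, Tag 01FG] -/
theorem resOfFullObj_app_d_apply {n : ℕ} (V : X.Opens) (s : Γ(Cech.obj U n M, V)) (γ : Idx ι (n + 1)) :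
    ((resOfFullObj U M (n + 1)).app V ((Cech.d U M n).app V s) : Cech.Sections (faces U (n + 1)) 0 M V) γ =
      ∑ j : Fin (n + 2), (-1 : ℤ) ^ (j : ℕ) • Cech.res M (inf_face_faces_le_comp_succAbove U V γ j)
        ((s : Cech.Sections U n M V) (enum γ ∘ Fin.succAbove j)) := by
  rw [resOfFullObj_app_apply, Cech.d_app_apply, map_sum]
  refine Finset.sum_congr rfl fun j _ => ?_
  rw [map_zsmul, Cech.res_res]

/-- **The restriction commutes with the differentials**: `res ≫ d_ord = d_full ≫ res` — reindex the ordered differential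
`Σ_{a ∈ τ} ε(τ,a) c_{τ∖a}|` over the positions of the sorted enumeration of `τ`. [cite: StacksProject, Tag 01FG]
[cite: GortzWedhorn2023, Def. 21.68 (p. 180)] -/
theorem resOfFullObj_d (n : ℕ) : resOfFullObj U M n ≫ d U M n = Cech.d U M n ≫ resOfFullObj U M (n + 1) := by
  refine Cech.hom_ext_to fun V s γ => ?_
  rw [Scheme.Modules.Hom.comp_app, Scheme.Modules.Hom.comp_app, CategoryTheory.comp_apply,
    CategoryTheory.comp_apply, d_app_resOfFullObj_apply, resOfFullObj_app_d_apply]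

/-- **`res : Č•(𝓤, M) → Č•_ord(𝓤, M)`** as a morphism of cochain complexes of `𝒪_X`-modules. [cite: StacksProject, Tag 01FG] -/
def resOfFull : Cech.complex U M ⟶ complex U M :=
  CochainComplex.ofHom (fun n => resOfFullObj U M n) fun n => by
    rw [Cech.complex_d, complex_d]; exact resOfFullObj_d U M n

/-- Components of `resOfFull`. [cite: StacksProject, Tag 01FG] -/
@[simp] theorem resOfFull_f (n : ℕ) : (resOfFull U M).f n = resOfFullObj U M n := rfl

omit [Fintype ι] in
/-- **The restriction is compatible with the augmentations**: `ε ≫ res⁰ = ε_ord`. [cite: StacksProject, Tag 01FG] -/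
theorem augment_resOfFullObj : Cech.augment U M ≫ resOfFullObj U M 0 = augment U M :=
  Cech.hom_ext_to fun V x β => by
    rw [Scheme.Modules.Hom.comp_app, CategoryTheory.comp_apply, resOfFullObj_app_apply, Cech.augment_app_apply,
      Cech.res_res]
    rfl

/-! ## §2 The Leray square: `H(res)` is an isomorphism -/

section Leray

variable [HasExt.{w} X.Modules]

/-- **The Leray square for `res`**: `Hⁿ⁺¹(Γ(X, res)) ∘ Leray_full = Leray_ord` on `Extⁿ⁺¹(𝒪_X, M)` — ★
`AcyclicResolution.extAddEquivHomologySucc_naturality` for the morphism `(𝟙_M, res)` of exact, `Ext(𝒪_X, –)`-acyclic augmented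
complexes (full and ordered Čech resolutions of `M`, affine faces, `M` affine-localizing).
[cite: StacksProject, Tag 01FM] [cite: GortzWedhorn2023, Thm. 22.9 (p. 236)] [cite: Hartshorne1977, III Thm. 4.5] -/
theorem homologyMap_resOfFull_extUnitAddEquivHomologySucc
    (hU : ∀ {m : ℕ} (β : Fin (m + 1) → ι), IsAffineOpen (face U β))
    (hU' : ∀ s : Finset ι, s.Nonempty → IsAffineOpen (faceSet U s))
    (hcov : ⨆ i, U i = ⊤) (hM : IsAffineLocalizing M) (n : ℕ) (x : Ext.{w} (unitModule X) M (n + 1)) :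
    (HomologicalComplex.homologyMap (AcyclicResolution.extComplexMap (unitModule X) (resOfFull U M)) (n + 1)).hom
        (Cech.extUnitAddEquivHomologySucc U M hU hcov hM n x) =
      extUnitAddEquivHomologySucc U M hU' hcov hM n x := by
  haveI := (Cech.exactAugmentation U M hcov).mono_ε
  haveI := (exactAugmentation U M hcov).mono_ε
  have hg : (Cech.exactAugmentation U M hcov).ε ≫ (resOfFull U M).f 0 = 𝟙 M ≫ (exactAugmentation U M hcov).ε := by
    rw [Category.id_comp, Cech.exactAugmentation_ε, exactAugmentation_ε, resOfFull_f]
    exact augment_resOfFullObj U M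
  have h := AcyclicResolution.extAddEquivHomologySucc_naturality (unitModule X) (resOfFull U M)
    (Cech.exactAugmentation U M hcov).ε (Cech.exactAugmentation U M hcov).ε_d (Cech.exactAugmentation U M hcov).exact₀
    (exactAugmentation U M hcov).ε (exactAugmentation U M hcov).ε_d (exactAugmentation U M hcov).exact₀
    (𝟙 M) hg (Cech.exactAugmentation U M hcov).exactAt_succ
    (fun k q e => (Cech.subsingleton_ext_unit_obj_of_isAffineLocalizing.{w} U k hU hcov hM q).elim e 0)
    (exactAugmentation U M hcov).exactAt_succ
    (fun k q e => (subsingleton_ext_unit_complex_X U M hU' hcov hM k q).elim e 0) n x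
  rw [Ext.comp_mk₀_id] at h
  exact h

/-- **`Hⁿ⁺¹(Γ(X, res)) : Hⁿ⁺¹(Γ(X, Č•(𝓤, M))) → Hⁿ⁺¹(Γ(X, Č•_ord(𝓤, M)))` is BIJECTIVE** for a finite cover with affine
faces and `M` affine-localizing — it is `Leray_ord ∘ Leray_full⁻¹` (no properness, no dimension count).  Hence the
cohomology RING of the ordered complex is the transport of the order-free one of the full complex (consumers: the (iv)∕J3
packet's pull-backs along non-monotone index maps). [cite: StacksProject, Tag 01FM] [cite: GortzWedhorn2023, Thm. 22.9 (p. 236)] -/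
theorem homologyMap_resOfFull_bijective
    (hU : ∀ {m : ℕ} (β : Fin (m + 1) → ι), IsAffineOpen (face U β))
    (hU' : ∀ s : Finset ι, s.Nonempty → IsAffineOpen (faceSet U s))
    (hcov : ⨆ i, U i = ⊤) (hM : IsAffineLocalizing M) (n : ℕ) :
    Function.Bijective
      (HomologicalComplex.homologyMap (AcyclicResolution.extComplexMap (unitModule X) (resOfFull U M)) (n + 1)).hom := by
  have hfac : ⇑(HomologicalComplex.homologyMap (AcyclicResolution.extComplexMap (unitModule X) (resOfFull U M))
      (n + 1)).hom = ⇑(extUnitAddEquivHomologySucc U M hU' hcov hM n) ∘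
        ⇑(Cech.extUnitAddEquivHomologySucc U M hU hcov hM n).symm := by
    funext y
    simp only [Function.comp_apply]
    rw [← homologyMap_resOfFull_extUnitAddEquivHomologySucc U M hU hU' hcov hM n, AddEquiv.apply_symm_apply]
  rw [hfac]
  exact (extUnitAddEquivHomologySucc U M hU' hcov hM n).bijective.comp
    (Cech.extUnitAddEquivHomologySucc U M hU hcov hM n).symm.bijective

/-- **Degree `0`**: `H⁰(Γ(X, res)) ∘ Leray_full = Leray_ord` on `Ext⁰(𝒪_X, M) = Γ(X, M)` (any open cover). [cite: StacksProject, Tag 01FM] -/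
theorem homologyMap_resOfFull_extUnitAddEquivHomologyZero (hcov : ⨆ i, U i = ⊤) (x : Ext.{w} (unitModule X) M 0) :
    (HomologicalComplex.homologyMap (AcyclicResolution.extComplexMap (unitModule X) (resOfFull U M)) 0).hom
        (Cech.extUnitAddEquivHomologyZero U M hcov x) =
      extUnitAddEquivHomologyZero U M hcov x := by
  haveI := (Cech.exactAugmentation U M hcov).mono_ε
  haveI := (exactAugmentation U M hcov).mono_ε
  have hg : (Cech.exactAugmentation U M hcov).ε ≫ (resOfFull U M).f 0 = 𝟙 M ≫ (exactAugmentation U M hcov).ε := by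
    rw [Category.id_comp, Cech.exactAugmentation_ε, exactAugmentation_ε, resOfFull_f]
    exact augment_resOfFullObj U M
  have h := AcyclicResolution.extAddEquivHomologyZero_naturality (unitModule X) (resOfFull U M)
    (Cech.exactAugmentation U M hcov).ε (Cech.exactAugmentation U M hcov).ε_d (Cech.exactAugmentation U M hcov).exact₀
    (exactAugmentation U M hcov).ε (exactAugmentation U M hcov).ε_d (exactAugmentation U M hcov).exact₀
    (𝟙 M) hg x
  rw [Ext.comp_mk₀_id] at h
  exact h

/-- **Degree `0`**: `H⁰(Γ(X, res))` is bijective for every open cover. [cite: StacksProject, Tag 01FM] -/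
theorem homologyMap_resOfFull_bijective_zero (hcov : ⨆ i, U i = ⊤) :
    Function.Bijective
      (HomologicalComplex.homologyMap (AcyclicResolution.extComplexMap (unitModule X) (resOfFull U M)) 0).hom := by
  have hfac : ⇑(HomologicalComplex.homologyMap (AcyclicResolution.extComplexMap (unitModule X) (resOfFull U M)) 0).hom =
      ⇑(extUnitAddEquivHomologyZero U M hcov) ∘ ⇑(Cech.extUnitAddEquivHomologyZero U M hcov).symm := by
    funext y
    simp only [Function.comp_apply]
    rw [← homologyMap_resOfFull_extUnitAddEquivHomologyZero U M hcov, AddEquiv.apply_symm_apply]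
  rw [hfac]
  exact (extUnitAddEquivHomologyZero U M hcov).bijective.comp (Cech.extUnitAddEquivHomologyZero U M hcov).symm.bijective

end Leray

end CechOrd

end Literature.AlgebraicGeometry.Modules

end
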